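import Literature.Barriers.CriticalPhenomena.RigorousRGSmallParameterFRDEstimates
import HarnessLib

/-!
# `RigorousRGSmallParameter` (Slade, Theorem 1.4.1): the continuum approximation of the
# decomposition profile — Bauerschmidt's "discrete approximation" `|W*_t - W_t| ≲ t⁻¹(1+t²λ)^{-l}`

First file of the self-similarity layer (Slade §10.3) under the proof architecture of the
barrier `RigorousRGSmallParameter.lean`. Slade, *Critical exponents for long-range `O(n)` models
below the upper critical dimension*, Commun. Math. Phys. **358** (2018), §10.3: "We recall that
there is a function `w̄` such that `w` of (3.x) obeys (10.38) `w(t,x;s) = (c/t)^{d-2}w̄(cx/t;st²) +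
O(t^{-(d-1)}(1+st²)^{-p})`, with the error estimate valid for any `p ≥ 0` and uniform in bounded
`s` … (see [Baue13a]; `w` is called `φ*` in [BBS-rg-pt, Baue13a], and `w̄` is `φ̄` of [Baue13a])";
this is the input of Lemma 10.3.1 (`C_{j;0,x} = L^{-(d-α)j}(c_0(L^{-j}x, m²L^{αj}) + O(L^{-j}))`),
hence of Lemmas 5.2.2–5.2.4. In [Baue13a] = R. Bauerschmidt, *A simple method for finite range
decomposition of quadratic forms and Gaussian fields*, Probab. Theory Related Fields **157**
(2013) 817–845, the lattice kernel is `φ*_t(x) = t²∫_{[-π,π]^d}W*_t(a*(ξ)+m²)e^{iξ·x}dξ` with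
`W*_t(λ) = Σ_{n∈ℤ}φ(arccos(1-½λ)t - 2πnt)` (its display (eq:W-discr)) — our `FRD.chebyProfile` for
the profile `f = φ` — and the continuum kernel is built from `W_t(λ) = φ(√λ t)`; the comparison of
the two rests on **Proposition 3.1 (Discrete approximation)**: "Let `φ` be as in Lemmas 2.5 and 2.6,
with associated functions `W_t` and `W*_t` for `γ = 1`. Then, for any integer `l`,
`|W*_t(λ) - W_t(λ)| ≤ C_l(1∨t)^{-1}(1+t²λ)^{-l}` for all `λ ∈ [0,4]`. In particular,
`W*_t(λ/t²) → Cφ(λ^{½})` as `t → ∞`", with its proof ("The left-hand side is then proportional to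
the absolute value of `φ(arccos(1-½λ)t) - φ(λ^{½}t) + Σ_{n∈ℤ∖{0}}φ(arccos(1-½λ)t + 2πnt)` … The first
two terms can be written as `(arccos(1-½λ) - λ^{½})tζ_t(λ)` with `ζ_t(λ) = ∫₀¹φ'(s arccos(1-½λ)t +
(1-s)λ^{½}t)ds`. The bounds `√(2λ) = arccos(1-λ) + O(λ)`, `√(2λ) ≤ arccos(1-λ) ≤ (π/2)√(2λ)`, and the
rapid decay of `φ'` therefore imply `|ζ_t(λ)| ≤ C_l(1+λt²)^{-l}` and `φ(arccos(1-½λ)t) - φ(λ^{½}t) ≤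
C_lt^{-1}(1+t²λ)^{-l}`. To estimate the sum … `Σ_{n∈ℤ∖{0}}φ(xt+2πnt) ≤ C_lΣ(1+xt+2πnt)^{-l} ≤ … ≤
C_lt^{-2l}(1+t²λ)^{-l}`").

## What this file proves (everything; no definition and no named fact is introduced)

* `FRD.norm_deriv_le_div_one_add_pow` — rapid decay of the derivative of a Schwartz profile.
* `FRD.two_sin_half_bounds` (`(2/π)x ≤ 2sin(x/2) ≤ x` on `[0,π]`), `FRD.sub_two_sin_half_le_cube`
  (`x - 2sin(x/2) ≤ x³/24`), `FRD.sqrt_eq_two_sin_half_arccos` (`√ζ = 2sin(x/2)`,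
  `x = arccos(1-½ζ)`) — the printed `arccos`/square-root comparisons in the variable `x`;
  `FRD.inv_pow_le_inv_pow_mul`, `FRD.hasSum_majorant_off_zero` (`Σ_{n≠0}(π²n²)⁻¹ = ⅓`).
* **`FRD.abs_chebyProfile_sub_le`** — **Proposition 3.1 of [Baue13a], PROVED for every even real
  Schwartz profile `F`** (only the rapid decay of `F` and `F'` is used): for every `l`,
  `|P_t(ζ) - Re F(t√ζ)| ≤ C_l t⁻¹(1+t²ζ)^{-l}` for `t ≥ 1`, `ζ ∈ [0,4]` (the proof gives `t⁻²`);
  **`FRD.abs_chebyProfile_profile_sub_le`** — the instance for the concrete profile of the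
  decomposition; `FRD.abs_profile_sqrt_le` — the decay `|Re F(t√ζ)| ≤ C_l(1+t²ζ)^{-l}` of the
  continuum profile.
-/

noncomputable section

namespace Literature.Barriers.CriticalPhenomena

open _root_.MeasureTheory Set Filter
open scoped _root_.Topology Real FourierTransform

namespace LongRangePhi4

namespace FRD

/-! ### Decay of the derivative of a Schwartz profile -/

/-- **Decay of the derivative of a Schwartz function**: `‖F'(u)‖ ≤ C(1+|u|)^{-K}` for every `K`
("the rapid decay of `φ'`"). [cite: Bauerschmidt2013, Proposition 3.1 (proof: "the rapid decay of φ'")] -/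
theorem norm_deriv_le_div_one_add_pow (F : SchwartzMap ℝ ℂ) (K : ℕ) :
    ∃ C : ℝ, 0 < C ∧ ∀ u : ℝ, ‖deriv F u‖ ≤ C / (1 + |u|) ^ K := by
  obtain ⟨C, hC, h⟩ := norm_le_div_one_add_pow (SchwartzMap.derivCLM ℝ ℂ F) K
  refine ⟨C, hC, fun u => ?_⟩
  have := h u
  rwa [SchwartzMap.derivCLM_apply] at this

/-! ### Elementary trigonometric facts for `x = arccos(1 - ½ζ)` -/

/-- For `x ∈ [0,π]`: `(2/π)x ≤ 2 sin(x/2) ≤ x` (Jordan's inequality and `sin y ≤ y`).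
[cite: Bauerschmidt2013, Proposition 3.1 (display: √(2λ) ≤ arccos(1-λ) ≤ (π/2)√(2λ))] -/
theorem two_sin_half_bounds {x : ℝ} (hx0 : 0 ≤ x) (hxπ : x ≤ π) :
    2 / π * x ≤ 2 * Real.sin (x / 2) ∧ 2 * Real.sin (x / 2) ≤ x := by
  constructor
  · have h := Real.mul_le_sin (x := x / 2) (by linarith) (by linarith)
    linarith
  · have h := Real.sin_le (x := x / 2) (by linarith)
    linarith

/-- For `x ≥ 0`: `x - 2sin(x/2) ≤ x³/24` (Taylor: `sin y ≥ y - y³/6`).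
[cite: Bauerschmidt2013, Proposition 3.1 (display: √(2λ) = arccos(1-λ) + O(λ))] -/
theorem sub_two_sin_half_le_cube {x : ℝ} (hx0 : 0 ≤ x) : x - 2 * Real.sin (x / 2) ≤ x ^ 3 / 24 := by
  rcases hx0.lt_or_eq with hx | hx
  · have h := Real.sin_gt_sub_cube (x := x / 2) (by linarith)
    nlinarith
  · subst hx
    simp

/-- `√ζ = 2 sin(x/2)` for `x = arccos(1 - ½ζ)`, `ζ ∈ [0,4]`. [cite: BauerschmidtBrydgesSlade2019RG, Ch. 3, "Finite-range decomposition: lattice" (ζ = 4sin²(½x))] -/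
theorem sqrt_eq_two_sin_half_arccos {ζ : ℝ} (h0 : 0 ≤ ζ) (h4 : ζ ≤ 4) :
    Real.sqrt ζ = 2 * Real.sin (Real.arccos (1 - ζ / 2) / 2) := by
  have h := four_mul_sin_sq_half_arccos h0 h4
  have hs : 0 ≤ Real.sin (Real.arccos (1 - ζ / 2) / 2) :=
    Real.sin_nonneg_of_nonneg_of_le_pi (by linarith [Real.arccos_nonneg (1 - ζ / 2)])
      (by linarith [Real.arccos_le_pi (1 - ζ / 2), Real.pi_pos])
  have hsq : (2 * Real.sin (Real.arccos (1 - ζ / 2) / 2)) ^ 2 = ζ := by linear_combination h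
  calc Real.sqrt ζ = Real.sqrt ((2 * Real.sin (Real.arccos (1 - ζ / 2) / 2)) ^ 2) := by rw [hsq]
    _ = 2 * Real.sin (Real.arccos (1 - ζ / 2) / 2) := Real.sqrt_sq (by linarith)

/-- For `n ≠ 0`, `t ≥ 1`, `K ≥ 2`: `(1 + tπ|n|)^{-K} ≤ t^{-K}(π²n²)⁻¹`.
[cite: Bauerschmidt2013, Proposition 3.1 (proof, the sum over n ≠ 0)] -/
theorem inv_pow_le_inv_pow_mul {t : ℝ} (ht : 1 ≤ t) {K : ℕ} (hK : 2 ≤ K) {n : ℤ} (hn : n ≠ 0) :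
    ((1 + t * π * |(n : ℝ)|) ^ K)⁻¹ ≤ (t ^ K)⁻¹ * (π ^ 2 * (n : ℝ) ^ 2)⁻¹ := by
  have hn' : (1 : ℝ) ≤ |(n : ℝ)| := by
    rw [← Int.cast_abs]
    exact_mod_cast Int.one_le_abs hn
  have hπ := Real.pi_pos
  have hb0 : 0 < π * |(n : ℝ)| := by positivity
  have hb1 : (1 : ℝ) ≤ π * |(n : ℝ)| := by nlinarith [Real.two_le_pi]
  have ht0 : 0 < t := by linarith
  calc ((1 + t * π * |(n : ℝ)|) ^ K)⁻¹ ≤ ((t * (π * |(n : ℝ)|)) ^ K)⁻¹ := by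
        apply inv_anti₀ (by positivity)
        apply pow_le_pow_left₀ (by positivity)
        linarith
    _ = (t ^ K)⁻¹ * ((π * |(n : ℝ)|) ^ K)⁻¹ := by rw [mul_pow, mul_inv]
    _ ≤ (t ^ K)⁻¹ * ((π * |(n : ℝ)|) ^ 2)⁻¹ := by
        apply mul_le_mul_of_nonneg_left _ (by positivity)
        apply inv_anti₀ (by positivity)
        exact pow_le_pow_right₀ hb1 hK
    _ = (t ^ K)⁻¹ * (π ^ 2 * (n : ℝ) ^ 2)⁻¹ := by rw [mul_pow, sq_abs]

/-- `Σ_{n≠0} (π²n²)⁻¹ = 1/3` (`ζ(2) = π²/6`), as a `HasSum` over `ℤ` with the `n = 0` term zero.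
[folklore] -/
theorem hasSum_majorant_off_zero :
    HasSum (fun n : ℤ => if n = 0 then (0 : ℝ) else (π ^ 2 * (n : ℝ) ^ 2)⁻¹) (1 / 3) := by
  have h := hasSum_majorant.sub (hasSum_ite_eq (0 : ℤ) (1 : ℝ))
  have e : (fun n : ℤ => (if n = 0 then (1 : ℝ) else (π ^ 2 * (n : ℝ) ^ 2)⁻¹) -
      (if n = 0 then (1 : ℝ) else 0)) = fun n : ℤ => if n = 0 then (0 : ℝ) else (π ^ 2 * (n : ℝ) ^ 2)⁻¹ := by
    funext n
    split_ifs <;> simp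
  rw [e] at h
  rw [show (1 : ℝ) / 3 = 4 / 3 - 1 by norm_num]
  exact h

/-! ### Proposition 3.1 of [Baue13a]: the Chebyshev profile approximates the continuum profile -/

set_option maxHeartbeats 400000 in
/-- **Bauerschmidt's discrete approximation (Proposition 3.1 of [Baue13a]) for an even real
Schwartz profile**: with `W*_t(ζ) = P_t(ζ) = Σ_{n∈ℤ} F((arccos(1-½ζ) - 2πn)t)` (our `chebyProfile`)
and `W_t(ζ) = F(t√ζ)`, for every integer `l` there is `C_l` such that
`|W*_t(ζ) - W_t(ζ)| ≤ C_l t⁻¹ (1+t²ζ)^{-l}` for all `t ≥ 1`, `ζ ∈ [0,4]`. Printed: "Let `φ` be as in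
Lemmas 2.5 and 2.6, with associated functions `W_t` and `W*_t` for `γ = 1`. Then, for any integer `l`,
`|W*_t(λ) - W_t(λ)| ≤ C_l(1∨t)^{-1}(1+t²λ)^{-l}` for all `λ ∈ [0,4]`." Proof as printed: the `n = 0`
term minus `W_t` is `(arccos(1-½λ) - √λ)tζ_t(λ)`, `ζ_t` an average of `φ'` over the segment, bounded
through the rapid decay of `φ'` and `√(2λ) ≤ arccos(1-λ) ≤ (π/2)√(2λ)`, `arccos(1-λ) - √(2λ) = O(λ^{3/2})`
(here: `x - 2sin(x/2) ≤ x³/24`, `2sin(x/2) ≥ (2/π)x`, mean value inequality); the terms `n ≠ 0`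
are `≤ C_lΣ_{n≠0}(1+πt|n|)^{-K} ≤ Ct^{-K}`, and `t^{-2l} ≤ 5^l(1+t²ζ)^{-l}` on `ζ ≤ 4`.
[cite: Bauerschmidt2013, Proposition 3.1 ("Discrete approximation") and its proof] -/
theorem abs_chebyProfile_sub_le (F : SchwartzMap ℝ ℂ) (l : ℕ) :
    ∃ C : ℝ, 0 < C ∧ ∀ t : ℝ, 1 ≤ t → ∀ ζ ∈ Icc (0 : ℝ) 4,
      |chebyProfile (fun v => (F v).re) t ζ - (F (t * Real.sqrt ζ)).re| ≤
        C * t⁻¹ * ((1 + t ^ 2 * ζ) ^ l)⁻¹ := by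
  -- decay constants: `K₀ = 2l + 2` for `F`, `K₁ = 2l + 3` for `F'`
  obtain ⟨C₀, hC₀, hF⟩ := norm_le_div_one_add_pow F (2 * l + 2)
  obtain ⟨C₁, hC₁, hF'⟩ := norm_deriv_le_div_one_add_pow F (2 * l + 3)
  set cmain : ℝ := C₁ * (π / 2) ^ (2 * l + 3) / 24 with hcmain
  set csum : ℝ := C₀ * 2 ^ (2 * l + 2) * (1 / 3) * 5 ^ l with hcsum
  have hπ := Real.pi_pos
  refine ⟨cmain + csum + 1, by positivity, fun t ht ζ hζ => ?_⟩
  have ht0 : 0 < t := by linarith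
  set x : ℝ := Real.arccos (1 - ζ / 2) with hxdef
  have hx0 : 0 ≤ x := Real.arccos_nonneg _
  have hxπ : x ≤ π := Real.arccos_le_pi _
  set y : ℝ := 2 * Real.sin (x / 2) with hydef
  have hy : Real.sqrt ζ = y := by rw [hydef, hxdef]; exact sqrt_eq_two_sin_half_arccos hζ.1 hζ.2
  obtain ⟨hyx1, hyx2⟩ := two_sin_half_bounds hx0 hxπ
  have hy0 : 0 ≤ y := le_trans (by positivity) hyx1
  have hζx : ζ ≤ x ^ 2 := by
    have h := four_mul_sin_sq_half_arccos hζ.1 hζ.2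
    rw [← hxdef] at h
    rw [← h]
    exact four_mul_sin_sq_half_le_sq x
  -- `(1+t²ζ)^l ≤ (1+xt)^{2l}` and `(1+t²ζ)^l ≤ 5^l t^{2l}`
  have hζ0 : 0 ≤ t ^ 2 * ζ := mul_nonneg (sq_nonneg t) hζ.1
  have hD0 : 0 < (1 + t ^ 2 * ζ) ^ l := pow_pos (by linarith) l
  have hcmp1 : (1 + t ^ 2 * ζ) ^ l ≤ (1 + t * x) ^ (2 * l) := by
    rw [pow_mul]
    apply pow_le_pow_left₀ (by linarith)
    nlinarith [mul_nonneg ht0.le hx0, mul_le_mul_of_nonneg_left hζx (sq_nonneg t)]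
  have hcmp2 : (1 + t ^ 2 * ζ) ^ l ≤ 5 ^ l * t ^ (2 * l) := by
    rw [pow_mul, ← mul_pow]
    apply pow_le_pow_left₀ (by linarith)
    nlinarith [hζ.2, sq_nonneg t]
  -- the terms of the periodised sum and their summability
  set g : ℤ → ℝ := fun n => (F ((x - 2 * π * n) * t)).re with hg
  set b : ℤ → ℝ := fun n => C₀ * 2 ^ (2 * l + 2) * (t ^ (2 * l + 2))⁻¹ *
    (if n = 0 then (0 : ℝ) else (π ^ 2 * (n : ℝ) ^ 2)⁻¹) with hb
  have hgb : ∀ n, n ≠ 0 → |g n| ≤ b n := by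
    intro n hn
    have h1 : |g n| ≤ ‖F ((x - 2 * π * n) * t)‖ := Complex.abs_re_le_norm _
    have h2 := hF ((x - 2 * π * n) * t)
    have hu : |(x - 2 * π * n) * t| = t * |x - 2 * π * n| := by
      rw [abs_mul, abs_of_nonneg ht0.le, mul_comm]
    rw [hu] at h2
    have hhalf := half_le_one_add_mul_abs hx0 hxπ ht0.le n
    have hB : (1 + t * π * |(n : ℝ)|) / 2 ≤ 1 + t * |x - 2 * π * n| := by
      have : 0 ≤ t * x := mul_nonneg ht0.le hx0
      linarith
    have hq : 0 < (1 + t * π * |(n : ℝ)|) / 2 := by positivity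
    have h3 : C₀ / (1 + t * |x - 2 * π * n|) ^ (2 * l + 2) ≤
        C₀ * 2 ^ (2 * l + 2) * ((1 + t * π * |(n : ℝ)|) ^ (2 * l + 2))⁻¹ := by
      calc C₀ / (1 + t * |x - 2 * π * n|) ^ (2 * l + 2)
          ≤ C₀ / ((1 + t * π * |(n : ℝ)|) / 2) ^ (2 * l + 2) :=
            div_le_div_of_nonneg_left hC₀.le (by positivity) (pow_le_pow_left₀ hq.le hB _)
        _ = C₀ * 2 ^ (2 * l + 2) * ((1 + t * π * |(n : ℝ)|) ^ (2 * l + 2))⁻¹ := by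
            rw [div_pow]
            field_simp
    have h4 := inv_pow_le_inv_pow_mul ht (K := 2 * l + 2) (by omega) hn
    calc |g n| ≤ ‖F ((x - 2 * π * n) * t)‖ := h1
      _ ≤ C₀ / (1 + t * |x - 2 * π * n|) ^ (2 * l + 2) := h2
      _ ≤ C₀ * 2 ^ (2 * l + 2) * ((1 + t * π * |(n : ℝ)|) ^ (2 * l + 2))⁻¹ := h3
      _ ≤ C₀ * 2 ^ (2 * l + 2) * ((t ^ (2 * l + 2))⁻¹ * (π ^ 2 * (n : ℝ) ^ 2)⁻¹) :=
          mul_le_mul_of_nonneg_left h4 (by positivity)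
      _ = b n := by simp only [hb, if_neg hn]; ring
  have hbsum : HasSum b (C₀ * 2 ^ (2 * l + 2) * (t ^ (2 * l + 2))⁻¹ * (1 / 3)) :=
    hasSum_majorant_off_zero.mul_left _
  -- summability of `g` (from the bound with the `n = 0` term handled separately)
  set g' : ℤ → ℝ := fun n => if n = 0 then 0 else g n with hg'
  have hg'b : ∀ n, |g' n| ≤ b n := by
    intro n
    by_cases hn : n = 0
    · simp only [hg', hb, if_pos hn, abs_zero, mul_zero]
      exact le_rfl
    · simp only [hg', if_neg hn]
      exact hgb n hn
  have hg's : Summable fun n => |g' n| :=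
    Summable.of_nonneg_of_le (fun n => abs_nonneg _) hg'b hbsum.summable
  have hg's' : Summable g' := hg's.of_abs
  have hgs : Summable g := by
    have e : g = fun n => g' n + (if n = 0 then g 0 else 0) := by
      funext n
      by_cases hn : n = 0
      · subst hn; simp [hg']
      · simp [hg', hn]
    rw [e]
    exact hg's'.add (hasSum_ite_eq (0 : ℤ) (g 0)).summable
  -- `P_t(ζ) = g 0 + Σ' g'`
  have hP : chebyProfile (fun v => (F v).re) t ζ = g 0 + ∑' n, g' n := by
    unfold chebyProfile
    rw [periodicProfile_eq, ← hxdef]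
    exact hgs.tsum_eq_add_tsum_ite 0
  -- the `n ≠ 0` part
  have hsum : |∑' n, g' n| ≤ csum * (t ^ 2)⁻¹ * ((1 + t ^ 2 * ζ) ^ l)⁻¹ := by
    have h7 : |∑' n, g' n| ≤ ∑' n, |g' n| := by
      have := norm_tsum_le_tsum_norm (f := g') (by simpa only [Real.norm_eq_abs] using hg's)
      simpa only [Real.norm_eq_abs] using this
    have h8 : ∑' n, |g' n| ≤ ∑' n, b n := hg's.tsum_le_tsum hg'b hbsum.summable
    rw [hbsum.tsum_eq] at h8
    have h9 : (t ^ (2 * l + 2))⁻¹ ≤ (t ^ 2)⁻¹ * (5 ^ l * ((1 + t ^ 2 * ζ) ^ l)⁻¹) := by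
      rw [pow_add, mul_inv, mul_comm]
      apply mul_le_mul_of_nonneg_left _ (by positivity)
      rw [← div_eq_mul_inv, le_div_iff₀ hD0]
      calc (t ^ (2 * l))⁻¹ * (1 + t ^ 2 * ζ) ^ l ≤ (t ^ (2 * l))⁻¹ * (5 ^ l * t ^ (2 * l)) :=
            mul_le_mul_of_nonneg_left hcmp2 (by positivity)
        _ = 5 ^ l := by field_simp
    calc |∑' n, g' n| ≤ C₀ * 2 ^ (2 * l + 2) * (t ^ (2 * l + 2))⁻¹ * (1 / 3) := h7.trans h8
      _ ≤ C₀ * 2 ^ (2 * l + 2) * ((t ^ 2)⁻¹ * (5 ^ l * ((1 + t ^ 2 * ζ) ^ l)⁻¹)) * (1 / 3) := by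
          gcongr
      _ = csum * (t ^ 2)⁻¹ * ((1 + t ^ 2 * ζ) ^ l)⁻¹ := by rw [hcsum]; ring
  -- the main term: `F(xt) - F(yt)` by the mean value inequality
  have hmain : |g 0 - (F (t * Real.sqrt ζ)).re| ≤ cmain * (t ^ 2)⁻¹ * ((1 + t ^ 2 * ζ) ^ l)⁻¹ := by
    have e0 : g 0 = (F (x * t)).re := by simp [hg]
    rw [e0, hy, ← Complex.sub_re, mul_comm t y]
    refine (Complex.abs_re_le_norm _).trans ?_
    -- derivative bound on the segment `[yt, xt]`
    have hseg : ∀ u ∈ Icc (y * t) (x * t), ‖deriv F u‖ ≤ C₁ * (π / 2) ^ (2 * l + 3) *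
        ((1 + t * x) ^ (2 * l + 3))⁻¹ := by
      intro u hu
      have hu0 : 0 ≤ u := le_trans (by positivity) hu.1
      refine (hF' u).trans ?_
      rw [abs_of_nonneg hu0, div_eq_mul_inv, mul_assoc]
      apply mul_le_mul_of_nonneg_left _ hC₁.le
      -- `(1+u)^{-K} ≤ (1+yt)^{-K} ≤ (π/2)^K (1+xt)^{-K}`
      have hyt : 2 / π * (1 + t * x) ≤ 1 + u := by
        have h1 : 2 / π ≤ 1 := by rw [div_le_one hπ]; linarith [Real.two_le_pi]
        have h2 : 2 / π * (t * x) ≤ y * t := by nlinarith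
        nlinarith [hu.1]
      have hq0 : 0 < 2 / π * (1 + t * x) := by positivity
      calc ((1 + u) ^ (2 * l + 3))⁻¹ ≤ ((2 / π * (1 + t * x)) ^ (2 * l + 3))⁻¹ := by
            apply inv_anti₀ (by positivity)
            exact pow_le_pow_left₀ hq0.le hyt _
        _ = (π / 2) ^ (2 * l + 3) * ((1 + t * x) ^ (2 * l + 3))⁻¹ := by
            rw [mul_pow, mul_inv, ← inv_pow, inv_div]
    have hmvt := Convex.norm_image_sub_le_of_norm_deriv_le (s := Icc (y * t) (x * t))
      (fun u _ => F.differentiableAt) hseg (convex_Icc _ _)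
      (left_mem_Icc.2 (by nlinarith)) (right_mem_Icc.2 (by nlinarith))
    have hdiff : ‖x * t - y * t‖ ≤ x ^ 3 / 24 * t := by
      rw [Real.norm_eq_abs, ← sub_mul, abs_mul, abs_of_nonneg ht0.le,
        abs_of_nonneg (by linarith)]
      exact mul_le_mul_of_nonneg_right (sub_two_sin_half_le_cube hx0) ht0.le
    have hK : (x ^ 3 * t) * ((1 + t * x) ^ (2 * l + 3))⁻¹ ≤ (t ^ 2)⁻¹ * ((1 + t ^ 2 * ζ) ^ l)⁻¹ := by
      -- `x³t = t⁻²(xt)³ ≤ t⁻²(1+xt)³` and `(1+xt)^{2l} ≥ (1+t²ζ)^l`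
      have hA : 0 < 1 + t * x := by positivity
      have e : (1 + t * x) ^ (2 * l + 3) = (1 + t * x) ^ (2 * l) * (1 + t * x) ^ 3 := by
        rw [pow_add]
      rw [e, mul_inv, ← div_eq_mul_inv (t ^ 2)⁻¹]
      have h1 : x ^ 3 * t ≤ (t ^ 2)⁻¹ * (1 + t * x) ^ 3 := by
        rw [← div_eq_inv_mul, le_div_iff₀ (by positivity)]
        have : x * t ≤ 1 + t * x := by linarith
        calc x ^ 3 * t * t ^ 2 = (x * t) ^ 3 := by ring
          _ ≤ (1 + t * x) ^ 3 := pow_le_pow_left₀ (by positivity) this 3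
      calc x ^ 3 * t * (((1 + t * x) ^ (2 * l))⁻¹ * ((1 + t * x) ^ 3)⁻¹)
          ≤ (t ^ 2)⁻¹ * (1 + t * x) ^ 3 * (((1 + t * x) ^ (2 * l))⁻¹ * ((1 + t * x) ^ 3)⁻¹) :=
            mul_le_mul_of_nonneg_right h1 (by positivity)
        _ = (t ^ 2)⁻¹ * ((1 + t * x) ^ (2 * l))⁻¹ := by field_simp
        _ ≤ (t ^ 2)⁻¹ / (1 + t ^ 2 * ζ) ^ l := by
            rw [div_eq_mul_inv]
            exact mul_le_mul_of_nonneg_left (inv_anti₀ hD0 hcmp1) (by positivity)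
    calc ‖F (x * t) - F (y * t)‖
        ≤ C₁ * (π / 2) ^ (2 * l + 3) * ((1 + t * x) ^ (2 * l + 3))⁻¹ * ‖x * t - y * t‖ := hmvt
      _ ≤ C₁ * (π / 2) ^ (2 * l + 3) * ((1 + t * x) ^ (2 * l + 3))⁻¹ * (x ^ 3 / 24 * t) :=
          mul_le_mul_of_nonneg_left hdiff (by positivity)
      _ = cmain * ((x ^ 3 * t) * ((1 + t * x) ^ (2 * l + 3))⁻¹) := by rw [hcmain]; ring
      _ ≤ cmain * ((t ^ 2)⁻¹ * ((1 + t ^ 2 * ζ) ^ l)⁻¹) := mul_le_mul_of_nonneg_left hK (by positivity)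
      _ = cmain * (t ^ 2)⁻¹ * ((1 + t ^ 2 * ζ) ^ l)⁻¹ := by ring
  -- assemble; `t⁻² ≤ t⁻¹` for `t ≥ 1`
  have ht2 : (t ^ 2)⁻¹ ≤ t⁻¹ := by
    apply inv_anti₀ ht0
    nlinarith
  rw [hP]
  calc |g 0 + ∑' n, g' n - (F (t * Real.sqrt ζ)).re|
      = |(g 0 - (F (t * Real.sqrt ζ)).re) + ∑' n, g' n| := by ring_nf
    _ ≤ |g 0 - (F (t * Real.sqrt ζ)).re| + |∑' n, g' n| := abs_add_le _ _
    _ ≤ cmain * (t ^ 2)⁻¹ * ((1 + t ^ 2 * ζ) ^ l)⁻¹ + csum * (t ^ 2)⁻¹ * ((1 + t ^ 2 * ζ) ^ l)⁻¹ :=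
        add_le_add hmain hsum
    _ = (cmain + csum) * (t ^ 2)⁻¹ * ((1 + t ^ 2 * ζ) ^ l)⁻¹ := by ring
    _ ≤ (cmain + csum + 1) * t⁻¹ * ((1 + t ^ 2 * ζ) ^ l)⁻¹ :=
        mul_le_mul_of_nonneg_right (mul_le_mul (by linarith) ht2 (by positivity) (by positivity))
          (by positivity)

/-- **Proposition 3.1 of [Baue13a] for the concrete profile** of the decomposition:
`|P_t(ζ) - f(t√ζ)| ≤ C_l t⁻¹(1+t²ζ)^{-l}`, `t ≥ 1`, `ζ ∈ [0,4]`, `f = Re profile`.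
[cite: Bauerschmidt2013, Proposition 3.1] -/
theorem abs_chebyProfile_profile_sub_le (l : ℕ) :
    ∃ C : ℝ, 0 < C ∧ ∀ t : ℝ, 1 ≤ t → ∀ ζ ∈ Icc (0 : ℝ) 4,
      |chebyProfile (fun v => (profile v).re) t ζ - (profile (t * Real.sqrt ζ)).re| ≤
        C * t⁻¹ * ((1 + t ^ 2 * ζ) ^ l)⁻¹ :=
  abs_chebyProfile_sub_le profile l

/-- Decay of the continuum profile `W_t(ζ) = f(t√ζ)`: `|f(t√ζ)| ≤ C_l(1+t²ζ)^{-l}` (`t, ζ ≥ 0`).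
[cite: Bauerschmidt2013, Lemma 2.5 (display (eq:W-decay))] -/
theorem abs_profile_sqrt_le (F : SchwartzMap ℝ ℂ) (l : ℕ) :
    ∃ C : ℝ, 0 < C ∧ ∀ t : ℝ, 0 ≤ t → ∀ ζ : ℝ, 0 ≤ ζ →
      |(F (t * Real.sqrt ζ)).re| ≤ C * ((1 + t ^ 2 * ζ) ^ l)⁻¹ := by
  obtain ⟨C, hC, h⟩ := norm_le_div_one_add_pow F (2 * l)
  refine ⟨C, hC, fun t ht ζ hζ => ?_⟩
  have hs : 0 ≤ Real.sqrt ζ := Real.sqrt_nonneg ζ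
  have hu : |t * Real.sqrt ζ| = t * Real.sqrt ζ := abs_of_nonneg (mul_nonneg ht hs)
  have h1 := h (t * Real.sqrt ζ)
  rw [hu] at h1
  refine (Complex.abs_re_le_norm _).trans (h1.trans ?_)
  -- `(1 + t√ζ)^{2l} ≥ (1+t²ζ)^l`
  have hD0 : 0 < (1 + t ^ 2 * ζ) ^ l := pow_pos (by nlinarith [mul_nonneg (sq_nonneg t) hζ]) l
  rw [div_eq_mul_inv]
  apply mul_le_mul_of_nonneg_left _ hC.le
  apply inv_anti₀ hD0
  rw [pow_mul]
  apply pow_le_pow_left₀ (by positivity)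
  have : (t * Real.sqrt ζ) ^ 2 = t ^ 2 * ζ := by rw [mul_pow, Real.sq_sqrt hζ]
  nlinarith [mul_nonneg ht hs]

end FRD

end LongRangePhi4

end Literature.Barriers.CriticalPhenomena
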